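import Literature.Computability.MetaComplexity.EFModAddU
import Literature.Computability.MetaComplexity.EFCluster
import Literature.Computability.MetaComplexity.EFLogic
import HarnessLib

/-!
# Laws of uniform modular addition in extended Frege: splitting, range, congruence, commutativity

Layer D (uniform variant), part 2: the first laws of `ModAddU.modAddT` as polynomial-size
blocks over views. The two arithmetic laws are carry inductions in the sense of
`EFCluster.lean`: a `Cluster.System` whose invariant is the set of reachable carry states
(found by exhaustive search outside Lean, written as a DNF, and *verified* here: every
generated rule is checked sound by `FregeRule.check` / `FregeRule.checkD` via `decide`).

* `ModAddU.SplitData.isBlock_lines` (**splitting**, system `SP`, read at every position):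
  for the mask `mkᵢ = ge ∧ nᵢ` and the adder `F = R + mk`, `F ≡ S` bitwise —
  `R + ge·n = a + b` on `L` bits.
* `ModAddU.LtData.isBlock_lines` (**range**, system `LT` and its end rule): if `a < n` and
  `b < n` (comparator facts) then `R < n`.
* `ModAddU.PairData.isBlock_leibLines` / `isBlock_commLines` (**congruence**,
  **commutativity**): from the adder laws (`EFAdder.lean`) and subtractor congruence
  (`EFOrder.lean`).

## Sources

* S. A. Cook, R. A. Reckhow, *The relative efficiency of propositional proof systems*,
  J. Symbolic Logic 44 (1979), §2 (sound schematic rules).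
* J. Krajíček, *Bounded Arithmetic, Propositional Logic, and Complexity Theory* (CUP 1995),
  §9.2.
-/

namespace Literature.Computability.MetaComplexity

open _root_.Computability Complexity Complexity.PropForm Netlist Cluster

namespace ModAddU

/-! ### The carry systems (along the positions `i < L` of a modular adder `M`) -/

/-- **System `SP`** (leaves: state `1 γ` = comparison carry of `D`, `2 φ` = carry of the
re-addition `F = R + ge·n`; parameter `3 ge`; inputs `4 s` (sum bit of `S`), `5 n`; next
`6 γ'`, `7 φ'`; gates `8 ¬n`, `9 d`, `10 R`, `11 ge∧n`, `12` sum bit of `F`). Invariant: the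
reachable states (`φ ↔ ge ∧ ¬γ`). [folklore] -/
def SP : System where
  cins := [biimp (var 1) (const true), biimp (var 2) (const false)]
  shapes := [biimp (var 8) (neg (var 5)), biimp (var 9) (xor3F (var 4) (var 8) (var 1)),
    biimp (var 6) (majF (var 4) (var 8) (var 1)), biimp (var 10) (muxF (var 3) (var 9) (var 4)),
    biimp (var 11) (conj (var 3) (var 5)), biimp (var 12) (xor3F (var 10) (var 11) (var 2)),
    biimp (var 7) (majF (var 10) (var 11) (var 2))]
  inv := disj (conj (neg (var 1)) (conj (var 2) (var 3)))
    (disj (conj (neg (var 2)) (neg (var 3))) (conj (var 1) (neg (var 2))))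
  next := fun k => if k = 1 then 6 else if k = 2 then 7 else k

/-- The definitions among the premises of the per-position rule of `SP`. [folklore] -/
def dsSPPos : List (ℕ × PropForm ℕ) :=
  [(8, neg (var 5)), (9, xor3F (var 4) (var 8) (var 1)), (10, muxF (var 3) (var 9) (var 4)),
    (11, conj (var 3) (var 5)), (12, xor3F (var 10) (var 11) (var 2))]

/-- The per-position rule of `SP`: the sum bit of `F` is the sum bit of `S`.
[cite: CookReckhow1979, §2 (sound rule)] -/
def rSPPos : FregeRule := SP.endRule (dsSPPos.map fun d => biimp (var d.1) d.2) (biimp (var 12) (var 4))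

/-- **System `LT`** (the comparators `A = (a, n)`, `B = (b, n)`, the adder `S`, the comparator
of `D` and the comparator `C = (R, n)` of the result: state `1 α, 2 β, 3 σ, 4 γ, 5 ρ`;
parameter `6 ge`; inputs `7 a, 8 b, 9 n`; next `10 … 14`; gates `15, 16 ¬n`, `17 s`, `18 ¬n`,
`19 d`, `20 R`, `21 ¬n`). Invariant: the reachable states. [folklore] -/
def LT : System where
  cins := [biimp (var 1) (const true), biimp (var 2) (const true), biimp (var 3) (const false),
    biimp (var 4) (const true), biimp (var 5) (const true)]
  shapes := [biimp (var 15) (neg (var 9)), biimp (var 10) (majF (var 7) (var 15) (var 1)),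
    biimp (var 16) (neg (var 9)), biimp (var 11) (majF (var 8) (var 16) (var 2)),
    biimp (var 17) (xor3F (var 7) (var 8) (var 3)), biimp (var 12) (majF (var 7) (var 8) (var 3)),
    biimp (var 18) (neg (var 9)), biimp (var 19) (xor3F (var 17) (var 18) (var 4)),
    biimp (var 13) (majF (var 17) (var 18) (var 4)), biimp (var 20) (muxF (var 6) (var 19) (var 17)),
    biimp (var 21) (neg (var 9)), biimp (var 14) (majF (var 20) (var 21) (var 5))]
  inv := disj (disj (disj (conj (conj (neg (var 1)) (neg (var 2))) (conj (neg (var 3)) (conj (neg (var 4)) (var 6))))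
    (disj (conj (conj (neg (var 1)) (neg (var 2))) (conj (neg (var 4)) (neg (var 5))))
    (conj (conj (neg (var 1)) (var 2)) (conj (neg (var 3)) (conj (var 4) (var 6))))))
    (disj (disj (conj (conj (neg (var 1)) (var 3)) (conj (neg (var 4)) (neg (var 5))))
    (conj (conj (neg (var 2)) (neg (var 3))) (conj (var 4) (conj (neg (var 5)) (var 6)))))
    (disj (conj (conj (neg (var 2)) (var 3)) (conj (neg (var 4)) (neg (var 5))))
    (conj (conj (neg (var 3)) (var 4)) (conj (var 5) (neg (var 6)))))))
    (disj (disj (conj (conj (var 1) (neg (var 2))) (conj (var 3) (conj (neg (var 4)) (var 6))))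
    (disj (conj (conj (var 1) (neg (var 3))) (conj (var 4) (var 5)))
    (conj (conj (var 1) (var 2)) (conj (var 3) (conj (var 4) (var 6))))))
    (disj (disj (conj (conj (var 1) (var 2)) (conj (var 4) (var 5))) (conj (conj (var 2) (neg (var 3))) (conj (var 4) (var 5))))
    (disj (conj (conj (var 2) (var 3)) (conj (neg (var 4)) (conj (var 5) (var 6))))
    (conj (conj (var 3) (neg (var 4))) (conj (neg (var 5)) (neg (var 6)))))))
  next := fun k => if 1 ≤ k ∧ k ≤ 5 then k + 9 else k

/-- The end rule of `LT` (with the link `ge ↔ γ_L`, a reflexivity line): `R < n`.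
[cite: CookReckhow1979, §2 (sound rule)] -/
def rLTEnd : FregeRule := LT.endRule [neg (var 1), neg (var 2), biimp (var 6) (var 4)] (neg (var 5))

/-- The rules of the modular-addition layer. [cite: CookReckhow1979, §2] -/
def rules : List FregeRule := [SP.baseRule, SP.stepRule, rSPPos, LT.baseRule, LT.stepRule, rLTEnd]

/-- Soundness check. [cite: CookReckhow1979, §2 (sound rule)] -/
theorem check_SP_base : SP.baseRule.check = true := by decide +kernel
/-- Soundness check. [cite: CookReckhow1979, §2 (sound rule)] -/
theorem check_SP_step : SP.stepRule.checkD 6 SP.ds = true := by decide +kernel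
/-- Soundness check. [cite: CookReckhow1979, §2 (sound rule)] -/
theorem check_SP_pos : rSPPos.checkD 6 dsSPPos = true := by decide +kernel
/-- Soundness check. [cite: CookReckhow1979, §2 (sound rule)] -/
theorem check_LT_base : LT.baseRule.check = true := by decide +kernel
/-- Soundness check (the largest of the layer: 10 free leaves, about 25 s of kernel time).
[cite: CookReckhow1979, §2 (sound rule)] -/
theorem check_LT_step : LT.stepRule.checkD 10 LT.ds = true := by decide +kernel
/-- Soundness check. [cite: CookReckhow1979, §2 (sound rule)] -/
theorem check_LT_end : rLTEnd.check = true := by decide +kernel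

/-- Every rule of the layer is sound. [cite: CookReckhow1979, §2 (sound rule)] -/
theorem isSound_of_mem_rules : ∀ r ∈ rules, r.IsSound := by
  intro r hr
  simp only [rules, List.mem_cons, List.not_mem_nil, or_false] at hr
  rcases hr with rfl | rfl | rfl | rfl | rfl | rfl
  exacts [FregeRule.isSound_of_check check_SP_base, FregeRule.isSound_of_checkD check_SP_step,
    FregeRule.isSound_of_checkD check_SP_pos, FregeRule.isSound_of_check check_LT_base,
    FregeRule.isSound_of_checkD check_LT_step, FregeRule.isSound_of_check check_LT_end]

/-- The leaf side conditions of the two systems. [folklore] -/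
theorem leavesOK : SP.LeavesOK ∧ LT.LeavesOK :=
  ⟨System.leavesOK_of_leavesOKB (by decide +kernel), System.leavesOK_of_leavesOKB (by decide +kernel)⟩

/-! ### Generic helpers for instantiating systems -/

/-- Coherence of a leaf assignment, checked on a Boolean over-approximation of the leaves of the
invariant. [folklore] -/
theorem hcoh_of {S : System} {p : ℕ → Bool} (hp : allVarsB p S.inv = true) {act : ℕ → ℕ → ℕ} {W : ℕ}
    (h : ∀ i < W, ∀ k, p k = true → act (i + 1) k = act i (S.next k)) :
    ∀ i < W, ∀ k ∈ S.inv.vars, act (i + 1) k = act i (S.next k) := fun i hi k hk =>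
  h i hi k (allVarsB_eq_true hp k hk)

/-- No leaf `0`, from a Boolean check. [folklore] -/
theorem ne_zero_of_allVarsB {φ : PropForm ℕ} (h : allVarsB (fun k => decide (k ≠ 0)) φ = true) :
    ∀ k ∈ φ.vars, k ≠ 0 := fun k hk => by simpa using allVarsB_eq_true h k hk

/-- Membership in `rules` by position. [folklore] -/
theorem mem_rules {i : ℕ} (hi : i < rules.length) : rules[i] ∈ rules := List.getElem_mem hi

variable {G : FregeSystem} {K : PropForm ℕ} {Γ : Set (PropForm ℕ)}

/-! ### Law: splitting `R + ge·n = S` -/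

/-- The data of the splitting law: a modular adder `M` of width `L`, mask gates `mkᵢ = ge ∧ nᵢ`
and the adder `F = R + mk`. [folklore] -/
structure SplitData where
  /-- the modular adder -/
  M : View
  /-- its width -/
  L : ℕ
  /-- base of the mask gates -/
  bmk : ℕ
  /-- base of the adder `F = R + mk` -/
  bF : ℕ

namespace SplitData

/-- The mask gate `mkᵢ`. [folklore] -/
def msk (d : SplitData) (i : ℕ) : ℕ := d.bmk + i
/-- The definition of the mask gate `mkᵢ ↔ ge ∧ nᵢ`. [folklore] -/
def mkDef (d : SplitData) (i : ℕ) : PropForm ℕ := biimp (var (d.msk i)) (conj (var (d.M.ge d.L)) (var (d.M.n i)))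
/-- The adder `F = R + mk`. [folklore] -/
def F (d : SplitData) : Adder.View := ⟨d.bF, d.M.R d.L, d.msk⟩

/-- Leaf assignment of system `SP`. [folklore] -/
def act (d : SplitData) (i : ℕ) (k : ℕ) : ℕ :=
  [0, d.M.Dc d.L i, d.F.c i, d.M.ge d.L, d.M.S.s i, d.M.n i, d.M.Dc d.L (i + 1), d.F.c (i + 1), (d.M.D d.L).ny i,
    d.M.d d.L i, d.M.R d.L i, d.msk i, d.F.s i].getD k 0

/-- The lines of the splitting law: the invariant lines of `SP`, then `sᵢ(F) ↔ sᵢ(S)` for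
`i < L`. [folklore] -/
def lines (d : SplitData) (K : PropForm ℕ) : List (PropForm ℕ) :=
  SP.lines K d.act d.L ++ (List.range d.L).map fun i => ctx K (inst (d.act i) (biimp (var 12) (var 4)))

variable (d : SplitData)

/-- Availability of the shapes of `SP`. [folklore] -/
theorem avail (hM : d.M.Avail K Γ d.L) (hmk : ∀ i < d.L, ctx K (d.mkDef i) ∈ Γ) (hF : d.F.Avail K Γ false d.L) :
    ∀ i < d.L, ∀ φ ∈ SP.shapes, ctx K (inst (d.act i) φ) ∈ Γ := by
  intro i hi φ hφ
  simp only [SP, List.mem_cons, List.not_mem_nil, or_false] at hφ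
  rcases hφ with rfl | rfl | rfl | rfl | rfl | rfl | rfl
  exacts [hM.2.1.1 i hi, (hM.2.1.2.2 i hi).1, (hM.2.1.2.2 i hi).2, hM.2.2 i hi, hmk i hi, (hF.2 i hi).1, (hF.2 i hi).2]

/-- **The splitting law of modular addition inside Frege**: for a modular adder `M`, mask gates
`mkᵢ = ge ∧ nᵢ` and the adder `F = R + mk`, the sum bits of `F` are provably the sum bits of
`S = a + b`: `R + ge·n = a + b` on `L` bits (one carry induction, `SP`, read off at every
position; no hypothesis on the operands). [cite: CookReckhow1979, §2] -/
theorem isBlock_lines (hG : ∀ r ∈ rules, r ∈ G.rules) (hM : d.M.Avail K Γ d.L)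
    (hmk : ∀ i < d.L, ctx K (d.mkDef i) ∈ Γ) (hF : d.F.Avail K Γ false d.L) : G.IsBlock Γ (d.lines K) := by
  obtain ⟨okSP, -⟩ := leavesOK
  have h₁ : G.IsBlock Γ (SP.lines K d.act d.L) :=
    System.isBlock_lines okSP (hG _ (mem_rules (i := 0) (by decide))) (hG _ (mem_rules (i := 1) (by decide))) K d.act d.L
      (hcoh_of (p := fun k => decide (1 ≤ k ∧ k ≤ 3)) (by decide +kernel) fun i _ k hk => by
        simp only [decide_eq_true_eq] at hk
        obtain ⟨hk₁, hk₂⟩ := hk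
        interval_cases k <;> rfl)
      (fun φ hφ => by
        simp only [SP, List.mem_cons, List.not_mem_nil, or_false] at hφ
        rcases hφ with rfl | rfl
        exacts [hM.2.1.2.1, hF.1])
      (d.avail hM hmk hF)
  refine h₁.append (Scaffold.isBlock_of_forall fun θ hθ => ?_)
  obtain ⟨i, hi, rfl⟩ := List.mem_map.1 hθ
  rw [List.mem_range] at hi
  refine Or.inr (System.isInferredFrom_end okSP.inv_ne_zero (hG _ (mem_rules (i := 2) (by decide)))
    (System.forall_ne_zero_of_shapesOKB (by decide +kernel)) (ne_zero_of_allVarsB (by decide +kernel)) K d.act i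
    (Or.inr (System.mem_lines SP K d.act hi.le)) fun φ hφ => Or.inl ?_)
  simp only [dsSPPos, List.map_cons, List.map_nil, List.mem_cons, List.not_mem_nil, or_false] at hφ
  rcases hφ with rfl | rfl | rfl | rfl | rfl
  exacts [hM.2.1.1 i hi, (hM.2.1.2.2 i hi).1, hM.2.2 i hi, hmk i hi, (hF.2 i hi).1]

/-- Conclusions of the splitting law: `sᵢ(F) ↔ sᵢ(S)` for `i < L`. [folklore] -/
theorem mem_lines {i : ℕ} (hi : i < d.L) : ctx K (eqv (d.F.s i) (d.M.S.s i)) ∈ d.lines K :=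
  List.mem_append_right _ (List.mem_map.2 ⟨i, List.mem_range.2 hi, rfl⟩)

/-- Size of the splitting law. [folklore] -/
theorem proofSize_lines : proofSize (d.lines K) ≤ (2 * d.L + 1) * (K.size + 18) := by
  rw [lines, proofSize_append]
  have h₁ := System.proofSize_lines SP K d.act d.L
  have h₂ : proofSize ((List.range d.L).map fun i => ctx K (inst (d.act i) (biimp (var 12) (var 4)))) ≤ d.L * (K.size + 10) :=
    proofSize_map_range_le fun i _ => by simp [ctx, inst, subst, biimp, size]
  have hSP : SP.inv.size = 17 := by decide +kernel
  rw [hSP] at h₁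
  nlinarith [h₁, h₂]

end SplitData

/-! ### Law: the result of modular addition is `< n` -/

/-- The data of the range law: a modular adder `M` of width `L`, the comparators `A`, `B`
witnessing `a, b < n`, and the comparator `C = (R, n)` of the result. [folklore] -/
structure LtData where
  /-- the modular adder -/
  M : View
  /-- its width -/
  L : ℕ
  /-- base of the comparator `(a, n)` -/
  bA : ℕ
  /-- base of the comparator `(b, n)` -/
  bB : ℕ
  /-- base of the comparator `(R, n)` -/
  bC : ℕ

namespace LtData

/-- The comparator `(a, n)`. [folklore] -/
def A (d : LtData) : Sub.View := ⟨d.bA, d.M.a, d.M.n⟩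
/-- The comparator `(b, n)`. [folklore] -/
def B (d : LtData) : Sub.View := ⟨d.bB, d.M.b, d.M.n⟩
/-- The comparator `(R, n)` of the result. [folklore] -/
def C (d : LtData) : Sub.View := ⟨d.bC, d.M.R d.L, d.M.n⟩

/-- Leaf assignment of system `LT`. [folklore] -/
def act (d : LtData) (i : ℕ) (k : ℕ) : ℕ :=
  [0, d.A.ge d.L i, d.B.ge d.L i, d.M.S.c i, d.M.Dc d.L i, d.C.ge d.L i, d.M.ge d.L, d.M.a i, d.M.b i, d.M.n i,
    d.A.ge d.L (i + 1), d.B.ge d.L (i + 1), d.M.S.c (i + 1), d.M.Dc d.L (i + 1), d.C.ge d.L (i + 1),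
    d.A.ny i, d.B.ny i, d.M.S.s i, (d.M.D d.L).ny i, d.M.d d.L i, d.M.R d.L i, d.C.ny i].getD k 0

/-- The lines of the range law: the invariant lines of `LT`, the reflexivity line `ge ↔ ge`
(the link between the parameter and the final comparison carry), then `¬ge(C)` (`R < n`).
[folklore] -/
def lines (d : LtData) (K : PropForm ℕ) : List (PropForm ℕ) :=
  LT.lines K d.act d.L ++ ([ctx K (eqv (d.M.ge d.L) (d.M.ge d.L))] ++ [ctx K (inst (d.act d.L) (neg (var 5)))])

variable (d : LtData)

/-- Availability of the shapes of `LT`. [folklore] -/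
theorem avail (hM : d.M.Avail K Γ d.L) (hA : d.A.Avail K Γ d.L) (hB : d.B.Avail K Γ d.L) (hC : d.C.Avail K Γ d.L) :
    ∀ i < d.L, ∀ φ ∈ LT.shapes, ctx K (inst (d.act i) φ) ∈ Γ := by
  intro i hi φ hφ
  simp only [LT, List.mem_cons, List.not_mem_nil, or_false] at hφ
  rcases hφ with rfl | rfl | rfl | rfl | rfl | rfl | rfl | rfl | rfl | rfl | rfl | rfl
  exacts [hA.1 i hi, (hA.2.2 i hi).2, hB.1 i hi, (hB.2.2 i hi).2, (hM.1.2 i hi).1, (hM.1.2 i hi).2, hM.2.1.1 i hi,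
    (hM.2.1.2.2 i hi).1, (hM.2.1.2.2 i hi).2, hM.2.2 i hi, hC.1 i hi, (hC.2.2 i hi).2]

/-- **The range law of modular addition inside Frege**: for a modular adder with `a, b < n`,
the result `R` is provably `< n` (one carry induction, `LT`, and its end rule).
[cite: CookReckhow1979, §2] -/
theorem isBlock_lines (hG : ∀ r ∈ rules, r ∈ G.rules) (hGA : ∀ r ∈ Adder.rules, r ∈ G.rules)
    (hM : d.M.Avail K Γ d.L) (hA : d.A.Avail K Γ d.L) (hB : d.B.Avail K Γ d.L) (hC : d.C.Avail K Γ d.L)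
    (ha : ctx K (neg (var (d.A.ge d.L d.L))) ∈ Γ) (hb : ctx K (neg (var (d.B.ge d.L d.L))) ∈ Γ) :
    G.IsBlock Γ (d.lines K) := by
  obtain ⟨-, okLT⟩ := leavesOK
  have h₁ : G.IsBlock Γ (LT.lines K d.act d.L) :=
    System.isBlock_lines okLT (hG _ (mem_rules (i := 3) (by decide))) (hG _ (mem_rules (i := 4) (by decide))) K d.act d.L
      (hcoh_of (p := fun k => decide (1 ≤ k ∧ k ≤ 6)) (by decide +kernel) fun i _ k hk => by
        simp only [decide_eq_true_eq] at hk
        obtain ⟨hk₁, hk₂⟩ := hk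
        interval_cases k <;> rfl)
      (fun φ hφ => by
        simp only [LT, List.mem_cons, List.not_mem_nil, or_false] at hφ
        rcases hφ with rfl | rfl | rfl | rfl | rfl
        exacts [hA.2.1, hB.2.1, hM.1.1, hM.2.1.2.1, hC.2.1])
      (d.avail hM hA hB hC)
  have h₂ : G.IsBlock (Γ ∪ {χ | χ ∈ LT.lines K d.act d.L}) [ctx K (eqv (d.M.ge d.L) (d.M.ge d.L))] :=
    FregeSystem.IsBlock.singleton (Or.inr (FregeSystem.IsInferredFrom.of_rule (hGA _ Adder.mem_rules.1)
      (FregeSystem.sub [K, var (d.M.ge d.L)]) rfl FregeSystem.prems_nil))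
  refine h₁.append (h₂.append (FregeSystem.IsBlock.singleton (Or.inr ?_)))
  refine System.isInferredFrom_end okLT.inv_ne_zero (hG _ (mem_rules (i := 5) (by decide)))
    (System.forall_ne_zero_of_shapesOKB (by decide +kernel)) (ne_zero_of_allVarsB (by decide +kernel)) K d.act d.L
    (Or.inl (Or.inr (System.mem_lines LT K d.act le_rfl))) fun φ hφ => ?_
  simp only [List.mem_cons, List.not_mem_nil, or_false] at hφ
  rcases hφ with rfl | rfl | rfl
  exacts [Or.inl (Or.inl ha), Or.inl (Or.inl hb), Or.inr (List.mem_singleton_self _)]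

/-- Conclusion of the range law: `R < n` (the comparator `C` answers `<`). [folklore] -/
theorem mem_lines : ctx K (neg (var (d.C.ge d.L d.L))) ∈ d.lines K := by
  simp only [lines, List.mem_append]
  exact Or.inr (Or.inr (List.mem_singleton_self _))

/-- Size of the range law. [folklore] -/
theorem proofSize_lines : proofSize (d.lines K) ≤ (d.L + 3) * (K.size + 153) := by
  simp only [lines, proofSize_append, proofSize_singleton]
  have h₁ := System.proofSize_lines LT K d.act d.L
  have hLT : LT.inv.size = 152 := by decide +kernel
  simp only [ctx, eqv, inst, subst, size, FregeSystem.size_biimp, hLT] at h₁ ⊢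
  nlinarith [h₁]

end LtData

/-! ### Laws: congruence and commutativity of modular addition -/

/-- Two modular adders of the same width. [folklore] -/
structure PairData where
  /-- the first modular adder -/
  M₁ : View
  /-- the second modular adder -/
  M₂ : View
  /-- their width -/
  L : ℕ

namespace PairData

variable (d : PairData)

/-- The tail of the congruence laws: the subtractors wire by wire, then the outputs. [folklore] -/
def tail (K : PropForm ℕ) : List (PropForm ℕ) :=
  Sub.leibLines (d.M₁.D d.L) (d.M₂.D d.L) K d.L ++ (List.range d.L).map fun i => ctx K (eqv (d.M₁.R d.L i) (d.M₂.R d.L i))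

/-- **The tail of the congruence laws**: if the sum bits of the adders and the moduli of two
modular adders are provably equal, so are the subtractors and the outputs.
[cite: CookReckhow1979, §2] -/
theorem isBlock_tail (hGN : ∀ r ∈ Netlist.rules, r ∈ G.rules) (hGL : ∀ r ∈ Logic.rules, r ∈ G.rules)
    (h₁ : d.M₁.Avail K Γ d.L) (h₂ : d.M₂.Avail K Γ d.L) (hs : ∀ i < d.L, ctx K (eqv (d.M₁.S.s i) (d.M₂.S.s i)) ∈ Γ)
    (hn : ∀ i < d.L, ctx K (eqv (d.M₁.n i) (d.M₂.n i)) ∈ Γ) : G.IsBlock Γ (d.tail K) := by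
  refine (Sub.isBlock_leibLines hGN hGL _ _ h₁.2.1 h₂.2.1 hs hn).append (Scaffold.isBlock_of_forall fun θ hθ => ?_)
  obtain ⟨i, hi, rfl⟩ := List.mem_map.1 hθ
  rw [List.mem_range] at hi
  exact Or.inr (FregeSystem.IsInferredFrom.of_rule (hGN _ (rLeib_mem_rules Kind.mux))
    (FregeSystem.sub [K, var (d.M₁.R d.L i), var (d.M₁.ge d.L), var (d.M₁.d d.L i), var (d.M₁.S.s i),
      var (d.M₂.R d.L i), var (d.M₂.ge d.L), var (d.M₂.d d.L i), var (d.M₂.S.s i)]) rfl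
    (FregeSystem.prems_cons (Or.inl (h₁.2.2 i hi)) (FregeSystem.prems_cons (Or.inl (h₂.2.2 i hi))
      (FregeSystem.prems_cons (Or.inr (Sub.mem_leibLines (by omega)))
      (FregeSystem.prems_cons (Or.inr (Sub.mem_leibLines (by omega)))
      (FregeSystem.prems_cons (Or.inl (hs i hi)) FregeSystem.prems_nil))))))

/-- The output equalities are in the tail. [folklore] -/
theorem mem_tail {i : ℕ} (hi : i < d.L) : ctx K (eqv (d.M₁.R d.L i) (d.M₂.R d.L i)) ∈ d.tail K :=
  List.mem_append_right _ (List.mem_map.2 ⟨i, List.mem_range.2 hi, rfl⟩)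

/-- The comparison bits are equal, in the tail. [folklore] -/
theorem ge_mem_tail : ctx K (eqv (d.M₁.ge d.L) (d.M₂.ge d.L)) ∈ d.tail K :=
  List.mem_append_left _ (Sub.mem_leibLines (by omega))

/-- Size of the tail. [folklore] -/
theorem proofSize_tail : proofSize (d.tail K) ≤ (4 * d.L + 1) * (K.size + 10) := by
  rw [tail, proofSize_append]
  have h₁ := Sub.proofSize_leibLines (d.M₁.D d.L) (d.M₂.D d.L) K d.L
  have h₂ : proofSize ((List.range d.L).map fun i => ctx K (eqv (d.M₁.R d.L i) (d.M₂.R d.L i))) ≤ d.L * (K.size + 10) :=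
    proofSize_map_range_le fun j _ => by simp [ctx, eqv, size, FregeSystem.size_biimp]
  nlinarith [h₁, h₂]

/-- The lines of the congruence law. [folklore] -/
def leibLines (K : PropForm ℕ) : List (PropForm ℕ) := Adder.leibLines d.M₁.S d.M₂.S K d.L ++ d.tail K

/-- **Congruence of modular addition inside Frege.** [cite: CookReckhow1979, §2] -/
theorem isBlock_leibLines (hGN : ∀ r ∈ Netlist.rules, r ∈ G.rules) (hGL : ∀ r ∈ Logic.rules, r ∈ G.rules)
    (h₁ : d.M₁.Avail K Γ d.L) (h₂ : d.M₂.Avail K Γ d.L) (ha : ∀ i < d.L, ctx K (eqv (d.M₁.a i) (d.M₂.a i)) ∈ Γ)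
    (hb : ∀ i < d.L, ctx K (eqv (d.M₁.b i) (d.M₂.b i)) ∈ Γ) (hn : ∀ i < d.L, ctx K (eqv (d.M₁.n i) (d.M₂.n i)) ∈ Γ) :
    G.IsBlock Γ (d.leibLines K) :=
  (Adder.isBlock_leibLines hGN _ _ h₁.1 h₂.1 ha hb).append (d.isBlock_tail hGN hGL (h₁.mono Set.subset_union_left)
    (h₂.mono Set.subset_union_left) (fun i hi => Or.inr (Adder.mem_leibLines (by omega))) fun i hi => Or.inl (hn i hi))

/-- The lines of the commutativity law. [folklore] -/
def commLines (K : PropForm ℕ) : List (PropForm ℕ) := Adder.commLines d.M₁.S d.M₂.S K d.L ++ d.tail K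

/-- **Commutativity of modular addition inside Frege**: a modular adder on `(a, b)` and one on
`(b, a)` (same modulus) have provably equal outputs. [cite: CookReckhow1979, §2] -/
theorem isBlock_commLines (hGN : ∀ r ∈ Netlist.rules, r ∈ G.rules) (hGA : ∀ r ∈ Adder.rules, r ∈ G.rules)
    (hGL : ∀ r ∈ Logic.rules, r ∈ G.rules) (h₁ : d.M₁.Avail K Γ d.L) (h₂ : d.M₂.Avail K Γ d.L)
    (hab : ∀ i < d.L, ctx K (eqv (d.M₁.a i) (d.M₂.b i)) ∈ Γ) (hba : ∀ i < d.L, ctx K (eqv (d.M₁.b i) (d.M₂.a i)) ∈ Γ)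
    (hn : ∀ i < d.L, ctx K (eqv (d.M₁.n i) (d.M₂.n i)) ∈ Γ) : G.IsBlock Γ (d.commLines K) :=
  (Adder.isBlock_commLines hGN hGA _ _ h₁.1 h₂.1 hab hba).append (d.isBlock_tail hGN hGL
    (h₁.mono Set.subset_union_left) (h₂.mono Set.subset_union_left)
    (fun i hi => Or.inr (Adder.mem_commLines (by omega))) fun i hi => Or.inl (hn i hi))

/-- The output equalities of the congruence law. [folklore] -/
theorem mem_leibLines {i : ℕ} (hi : i < d.L) : ctx K (eqv (d.M₁.R d.L i) (d.M₂.R d.L i)) ∈ d.leibLines K :=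
  List.mem_append_right _ (d.mem_tail hi)

/-- The output equalities of the commutativity law. [folklore] -/
theorem mem_commLines {i : ℕ} (hi : i < d.L) : ctx K (eqv (d.M₁.R d.L i) (d.M₂.R d.L i)) ∈ d.commLines K :=
  List.mem_append_right _ (d.mem_tail hi)

/-- Size of the congruence law. [folklore] -/
theorem proofSize_leibLines : proofSize (d.leibLines K) ≤ (6 * d.L + 2) * (K.size + 10) := by
  rw [leibLines, proofSize_append]
  nlinarith [Adder.proofSize_leibLines d.M₁.S d.M₂.S K d.L, d.proofSize_tail (K := K)]

/-- Size of the commutativity law. [folklore] -/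
theorem proofSize_commLines : proofSize (d.commLines K) ≤ (6 * d.L + 2) * (K.size + 10) := by
  rw [commLines, proofSize_append]
  nlinarith [Adder.proofSize_commLines d.M₁.S d.M₂.S K d.L, d.proofSize_tail (K := K)]

end PairData

end ModAddU

end Literature.Computability.MetaComplexity
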